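import Mathlib.GroupTheory.Index
import Mathlib.Algebra.Order.Floor.Ring
import Mathlib.LinearAlgebra.StdBasis
import Mathlib.Data.Rat.Floor
import Mathlib.Data.Int.Interval
import Mathlib.Data.Fintype.BigOperators
import Mathlib.Algebra.Order.Archimedean.Real.Basic
import Mathlib.Combinatorics.Pigeonhole
import HarnessLib

/-!
# Counting points of a super-lattice `𝔑 ⊇ ℤⁿ` of `ℚⁿ` in a box, without Blichfeldt

Topic `NumberTheory/DiophantineGeometry`; namespace `Literature.NumberTheory.DiophantineGeometry.Dioph`.
Theorems only; no definition, no named fact.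

Matveev's auxiliary function (Yu. V. Nesterenko, *Linear forms in logarithms of rational numbers*,
LNM 1819 (2003), §3.3 Prop. 3.4(2), §3.5) takes its exponents in a set `𝔏` of points of the exponent
lattice `𝔑 = {λ ∈ ℚⁿ : α^λ ∈ ℚ} ⊇ ℤⁿ` lying in a box (and a slab), and needs
`|𝔏| ≍ N · (box count)`, `N = [𝔑 : ℤⁿ]`; print gets it from Blichfeldt's theorem (volume/covolume).
For a kernel frame the same count is DISCRETE and elementary:

* `exists_fract_representatives` — if `ℤⁿ ≤ 𝔑 ≤ ℚⁿ` has finite index `N = [𝔑 : ℤⁿ]`, then `𝔑` contains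
  `N` distinct points with all coordinates in `[0, 1)` (fractional parts of coset representatives);
* `card_image_add_intCast` — for a finite set `T` of points with coordinates in `[0,1)` and
  `s : Fin n → ℕ`, the points `t + z` (`t ∈ T`, `z ∈ ℤⁿ`, `−sⱼ ≤ zⱼ < sⱼ`) are pairwise distinct, so
  they number `#T · ∏ 2sⱼ`, and they lie in the box `|xⱼ| ≤ sⱼ`;
* `exists_finset_lattice_box` — hence `𝔑 ∩ {|xⱼ| ≤ sⱼ}` contains a finite set of exactly
  `N · ∏ⱼ 2sⱼ` points;
* `exists_slab_class` — the SLAB by pigeonhole: for a finite set `B`, a real functional `φ` with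
  `|φ| ≤ Θ` on `B` and a width `w > 0`, some sub-slab `{b ∈ B : c ≤ φ b < c + w}` carries at least the
  fraction `1/(2⌈Θ/w⌉ + 1)` of `B` (print: the CENTRED slab `|∑ wⱼ log αⱼ| ≤ L/η` has volume
  `≥ (2/(nη))·vol(box)` by Brunn–Minkowski, Cor. 3.5–Lemma 3.6; a non-centred slab of the same width
  costs a kernel frame only a twist factor `e^{cζ}`).

The index `N` is computed by Mathlib's `AddSubgroup.relIndex_eq_abs_det` when `𝔑` is given by a basis
(e.g. `𝔑 = C^{-T} ℤⁿ`, `N = |det C|`, bounded by `natAbs_det_le_prod_height` of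
`SaturationIndexBound.lean`); the slab / class restriction is the pigeonhole of
`Summit.ABC.StewartYu.SiegelFinset.exists_class_card_ge`. Everything here is [folklore].
WHAT THIS IS NOT: not Blichfeldt's theorem; no volumes; not a statement about any frame.

## References

* [Nesterenko2003] Yu. V. Nesterenko, *Linear forms in logarithms of rational numbers*, LNM 1819
  (2003) — §3.3 Prop. 3.4(2) (Blichfeldt), §3.5 (the set 𝔏, |𝔏| = [2N Lⁿ/(nηΩ)] + 1).
-/

noncomputable section

open Finset

namespace Literature.NumberTheory.DiophantineGeometry.Dioph

/-! ### Integer vectors lie in every super-lattice of `ℤⁿ` -/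

/-- An integer vector lies in the subgroup generated by the standard basis of `ℚⁿ` (the lattice
`ℤⁿ ≤ 𝔑` of Nesterenko's §3.4). [cite: Nesterenko2003, §3.4 (p. 105)] -/
theorem intCast_mem_closure_basisFun {n : ℕ} (z : Fin n → ℤ) :
    (fun j => (z j : ℚ)) ∈ AddSubgroup.closure (Set.range ⇑(Pi.basisFun ℚ (Fin n))) := by
  have h : (fun j => (z j : ℚ)) = ∑ i, z i • (Pi.basisFun ℚ (Fin n) i) := by
    conv_lhs => rw [← (Pi.basisFun ℚ (Fin n)).sum_repr (fun j => (z j : ℚ))]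
    refine Finset.sum_congr rfl fun i _ => ?_
    rw [Pi.basisFun_repr, Int.cast_smul_eq_zsmul]
  rw [h]
  exact sum_mem fun i _ => zsmul_mem (AddSubgroup.subset_closure (Set.mem_range_self i)) _

/-! ### Fractional-part representatives of `𝔑 / ℤⁿ` -/

/-- **`N = [𝔑 : ℤⁿ]` points of `𝔑` in the unit cube.** If `𝔑 ≤ ℚⁿ` contains `ℤⁿ` with finite
index `N`, then there is a finite set `T ⊆ 𝔑` of exactly `N` points all of whose coordinates lie in
`[0, 1)` (the fractional parts of a system of coset representatives; they are pairwise
incongruent modulo `ℤⁿ`; the discrete substitute for Blichfeldt's theorem as used in Prop. 3.4(2)).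
[cite: Nesterenko2003, §3.3 Prop 3.4(2) and the Blichfeldt theorem quoted on p. 104] -/
theorem exists_fract_representatives {n : ℕ} (Λ : AddSubgroup (Fin n → ℚ))
    (hZ : AddSubgroup.closure (Set.range ⇑(Pi.basisFun ℚ (Fin n))) ≤ Λ)
    (hfin : (AddSubgroup.closure (Set.range ⇑(Pi.basisFun ℚ (Fin n)))).relIndex Λ ≠ 0) :
    ∃ T : Finset (Fin n → ℚ),
      T.card = (AddSubgroup.closure (Set.range ⇑(Pi.basisFun ℚ (Fin n)))).relIndex Λ ∧
      (∀ t ∈ T, t ∈ Λ) ∧ (∀ t ∈ T, ∀ j, 0 ≤ t j ∧ t j < 1) := by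
  classical
  set Zn := AddSubgroup.closure (Set.range ⇑(Pi.basisFun ℚ (Fin n))) with hZn
  set K : AddSubgroup Λ := Zn.addSubgroupOf Λ with hK
  have hrel : Zn.relIndex Λ = K.index := rfl
  haveI : Fintype (Λ ⧸ K) := AddSubgroup.fintypeOfIndexNeZero (hrel ▸ hfin)
  -- representatives and their fractional parts
  set rep : Λ ⧸ K → Λ := Quotient.out with hrep
  have hrep_mk : ∀ c : Λ ⧸ K, (QuotientAddGroup.mk (rep c) : Λ ⧸ K) = c := fun c => Quotient.out_eq c
  set fr : (Fin n → ℚ) → (Fin n → ℚ) := fun x j => Int.fract (x j) with hfr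
  have hfr_mem : ∀ x ∈ Λ, fr x ∈ Λ := by
    intro x hx
    have hfl : (fun j => ((⌊x j⌋ : ℤ) : ℚ)) ∈ Λ := hZ (intCast_mem_closure_basisFun _)
    have : fr x = x - fun j => ((⌊x j⌋ : ℤ) : ℚ) := by
      funext j; simp only [hfr, Pi.sub_apply, Int.self_sub_floor]
    rw [this]
    exact Λ.sub_mem hx hfl
  -- injectivity of `c ↦ fr (rep c)`
  have hinj : Function.Injective fun c : Λ ⧸ K => fr (rep c : Fin n → ℚ) := by
    intro c c' hcc'
    have hdiff : ((rep c : Fin n → ℚ) - (rep c' : Fin n → ℚ)) ∈ Zn := by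
      have : ((rep c : Fin n → ℚ) - (rep c' : Fin n → ℚ)) =
          fun j => ((⌊(rep c : Fin n → ℚ) j⌋ - ⌊(rep c' : Fin n → ℚ) j⌋ : ℤ) : ℚ) := by
        funext j
        have hj := congrFun hcc' j
        simp only [hfr] at hj
        simp only [Pi.sub_apply]
        have ex := Int.floor_add_fract ((rep c : Fin n → ℚ) j)
        have ey := Int.floor_add_fract ((rep c' : Fin n → ℚ) j)
        push_cast
        linarith
      rw [this]
      exact intCast_mem_closure_basisFun _
    rw [← hrep_mk c, ← hrep_mk c']
    refine QuotientAddGroup.eq.mpr ?_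
    rw [hK, AddSubgroup.mem_addSubgroupOf]
    have : ((-rep c + rep c' : Λ) : Fin n → ℚ) = -((rep c : Fin n → ℚ) - (rep c' : Fin n → ℚ)) := by
      push_cast; ring
    rw [this]
    exact Zn.neg_mem hdiff
  refine ⟨Finset.univ.image fun c : Λ ⧸ K => fr (rep c : Fin n → ℚ), ?_, ?_, ?_⟩
  · rw [Finset.card_image_of_injective _ hinj, Finset.card_univ, hrel, AddSubgroup.index_eq_card,
      Nat.card_eq_fintype_card]
  · intro t ht
    obtain ⟨c, -, rfl⟩ := Finset.mem_image.mp ht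
    exact hfr_mem _ (rep c).2
  · intro t ht j
    obtain ⟨c, -, rfl⟩ := Finset.mem_image.mp ht
    exact ⟨Int.fract_nonneg _, Int.fract_lt_one _⟩

/-! ### Integer translates of the representatives -/

/-- **The translates `t + z` are distinct and fill the box.** For a finite set `T` of points of `ℚⁿ`
with coordinates in `[0,1)` and `s : Fin n → ℕ`, the map `(t, z) ↦ t + z` is injective on
`T × ∏ⱼ [−sⱼ, sⱼ)` (compare fractional parts), its image lies in the box `|xⱼ| ≤ sⱼ`, and has
`#T · ∏ⱼ 2sⱼ` elements. [cite: Nesterenko2003, §3.3 (3.13) and §3.5 (the count of 𝔏)] -/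
theorem card_image_add_intCast {n : ℕ} (T : Finset (Fin n → ℚ))
    (hT : ∀ t ∈ T, ∀ j, 0 ≤ t j ∧ t j < 1) (s : Fin n → ℕ) :
    let Z : Finset (Fin n → ℤ) := Fintype.piFinset fun j => Finset.Ico (-(s j : ℤ)) (s j)
    let φ : (Fin n → ℚ) × (Fin n → ℤ) → (Fin n → ℚ) := fun tz j => tz.1 j + (tz.2 j : ℚ)
    ((T ×ˢ Z).image φ).card = T.card * ∏ j, (2 * s j) ∧
      (∀ x ∈ (T ×ˢ Z).image φ, ∀ j, |x j| ≤ s j) ∧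
      (∀ x ∈ (T ×ˢ Z).image φ, ∃ t ∈ T, ∃ z : Fin n → ℤ, x = fun j => t j + (z j : ℚ)) := by
  intro Z φ
  classical
  have hinj : Set.InjOn φ ↑(T ×ˢ Z) := by
    rintro ⟨t, z⟩ htz ⟨t', z'⟩ htz' h
    simp only [Finset.coe_product, Set.mem_prod, Finset.mem_coe] at htz htz'
    have key : ∀ j, z j = z' j ∧ t j = t' j := by
      intro j
      have hj : t j + (z j : ℚ) = t' j + (z' j : ℚ) := congrFun h j
      obtain ⟨h0, h1⟩ := hT t htz.1 j
      obtain ⟨h0', h1'⟩ := hT t' htz'.1 j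
      have hzz : z j = z' j := by
        have hlt1 : ((z j : ℤ) : ℚ) < z' j + 1 := by linarith
        have hlt2 : ((z' j : ℤ) : ℚ) < z j + 1 := by linarith
        have i1 : z j < z' j + 1 := by exact_mod_cast hlt1
        have i2 : z' j < z j + 1 := by exact_mod_cast hlt2
        omega
      refine ⟨hzz, ?_⟩
      rw [hzz] at hj; linarith
    refine Prod.ext (funext fun j => (key j).2) (funext fun j => (key j).1)
  refine ⟨?_, ?_, ?_⟩
  · rw [Finset.card_image_of_injOn hinj, Finset.card_product, Fintype.card_piFinset]
    congr 1
    refine Finset.prod_congr rfl fun j _ => ?_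
    rw [Int.card_Ico]
    have : ((s j : ℤ) - -(s j : ℤ)) = (2 * s j : ℕ) := by push_cast; ring
    rw [this, Int.toNat_natCast]
  · intro x hx j
    obtain ⟨⟨t, z⟩, htz, rfl⟩ := Finset.mem_image.mp hx
    rw [Finset.mem_product] at htz
    obtain ⟨ht, hz⟩ := htz
    have hzj : z j ∈ Finset.Ico (-(s j : ℤ)) (s j) := Fintype.mem_piFinset.mp hz j
    rw [Finset.mem_Ico] at hzj
    obtain ⟨h0, h1⟩ := hT t ht j
    have hz0 : (-(s j : ℤ) : ℚ) ≤ (z j : ℚ) := by exact_mod_cast hzj.1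
    have hz1 : ((z j : ℤ) : ℚ) ≤ (s j : ℚ) - 1 := by
      have : z j ≤ (s j : ℤ) - 1 := by omega
      exact_mod_cast this
    rw [abs_le]
    push_cast at hz0
    constructor <;> simp only [φ] <;> linarith
  · intro x hx
    obtain ⟨⟨t, z⟩, htz, rfl⟩ := Finset.mem_image.mp hx
    rw [Finset.mem_product] at htz
    exact ⟨t, htz.1, z, rfl⟩

/-- **Points of a super-lattice of `ℤⁿ` in a box, counted without Blichfeldt.** If `𝔑 ≤ ℚⁿ`
contains `ℤⁿ` with finite index `N = [𝔑 : ℤⁿ]`, then for every `s : Fin n → ℕ` the box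
`{x : |xⱼ| ≤ sⱼ}` contains a finite subset of `𝔑` with exactly `N · ∏ⱼ 2sⱼ` elements (the `∃c`
substitute for Nesterenko's Prop. 3.4(2): `|𝔏| ≥ N · Lⁿ/Ω`-type counts).
[cite: Nesterenko2003, §3.3 Prop 3.4(2), §3.5 (discrete form)] -/
theorem exists_finset_lattice_box {n : ℕ} (Λ : AddSubgroup (Fin n → ℚ))
    (hZ : AddSubgroup.closure (Set.range ⇑(Pi.basisFun ℚ (Fin n))) ≤ Λ)
    (hfin : (AddSubgroup.closure (Set.range ⇑(Pi.basisFun ℚ (Fin n)))).relIndex Λ ≠ 0)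
    (s : Fin n → ℕ) :
    ∃ 𝔏 : Finset (Fin n → ℚ),
      𝔏.card = (AddSubgroup.closure (Set.range ⇑(Pi.basisFun ℚ (Fin n)))).relIndex Λ * ∏ j, (2 * s j) ∧
      (∀ x ∈ 𝔏, x ∈ Λ) ∧ (∀ x ∈ 𝔏, ∀ j, |x j| ≤ s j) := by
  classical
  obtain ⟨T, hTcard, hTΛ, hT01⟩ := exists_fract_representatives Λ hZ hfin
  obtain ⟨hcard, hbox, hform⟩ := card_image_add_intCast T hT01 s
  refine ⟨_, hTcard ▸ hcard, fun x hx => ?_, hbox⟩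
  obtain ⟨t, ht, z, rfl⟩ := hform x hx
  exact Λ.add_mem (hTΛ t ht) (hZ (intCast_mem_closure_basisFun z))

/-! ### The slab, by pigeonhole -/

/-- Some class of a map into a finite type with at most `N` elements carries the fraction `1/N` of a
finite set (pigeonhole; the twin of `Summit.ABC.StewartYu.SiegelFinset.exists_class_card_ge`, which a
Literature file cannot import). [folklore] -/
private theorem exists_class_card_ge' {ι γ : Type*} [DecidableEq γ] [Fintype γ] [Nonempty γ]
    (B : Finset ι) (cls : ι → γ) {N : ℕ} (hN : Fintype.card γ ≤ N) :
    ∃ c : γ, B.card ≤ N * (B.filter fun u => cls u = c).card := by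
  classical
  rcases Nat.eq_zero_or_pos B.card with h0 | hBpos
  · obtain ⟨c⟩ := (inferInstance : Nonempty γ)
    exact ⟨c, by rw [h0]; exact Nat.zero_le _⟩
  have hpos : 0 < Fintype.card γ := Fintype.card_pos
  set m : ℕ := (B.card - 1) / Fintype.card γ with hm
  obtain ⟨c, -, hc⟩ := Finset.exists_lt_card_fiber_of_mul_lt_card_of_maps_to
    (s := B) (t := (Finset.univ : Finset γ)) (f := cls) (n := m)
    (fun u _ => Finset.mem_univ _)
    (by
      rw [Finset.card_univ]
      have h1 : Fintype.card γ * m ≤ B.card - 1 := Nat.mul_div_le (B.card - 1) (Fintype.card γ)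
      omega)
  refine ⟨c, ?_⟩
  have h2 : B.card - 1 < Fintype.card γ * (m + 1) := Nat.lt_mul_div_succ (B.card - 1) hpos
  have h3 : B.card ≤ Fintype.card γ * (m + 1) := by omega
  calc B.card ≤ Fintype.card γ * (m + 1) := h3
    _ ≤ N * (m + 1) := Nat.mul_le_mul_right _ hN
    _ ≤ N * (B.filter fun u => cls u = c).card := Nat.mul_le_mul_left _ hc

/-- **Some sub-slab of width `w` carries the fraction `1/(2⌈Θ/w⌉+1)` of `B`.** For a finite set
`B`, a real functional `φ` with `|φ b| ≤ Θ` on `B` and a width `w > 0`, there is `c` (a multiple of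
`w`) such that `U = {b ∈ B : c ≤ φ b < c + w}` satisfies `#B ≤ (2⌈Θ/w⌉₊ + 1)·#U` (pigeonhole over
the classes `⌊φ b / w⌋ ∈ [−⌈Θ/w⌉, ⌈Θ/w⌉]`) — the discrete, non-centred substitute for the volume
bound of Nesterenko's Prop. 3.4(1) for the slab (3.12). [cite: Nesterenko2003, §3.3 (3.12), Prop 3.4(1)] -/
theorem exists_slab_class {ι : Type*} (B : Finset ι) (φ : ι → ℝ) {Θ w : ℝ} (hw : 0 < w)
    (hφ : ∀ b ∈ B, |φ b| ≤ Θ) :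
    ∃ c : ℝ, B.card ≤ (2 * ⌈Θ / w⌉₊ + 1) * (B.filter fun b => c ≤ φ b ∧ φ b < c + w).card := by
  classical
  set M : ℕ := ⌈Θ / w⌉₊ with hM
  -- the class map into `Fin (2M+1)`
  set cls : ι → Fin (2 * M + 1) := fun b =>
    ⟨min (⌊φ b / w⌋ + M).toNat (2 * M), by omega⟩ with hcls
  haveI : Nonempty (Fin (2 * M + 1)) := ⟨⟨0, by omega⟩⟩
  obtain ⟨c', hc'⟩ := exists_class_card_ge' B cls (le_of_eq (Fintype.card_fin _))
  refine ⟨(((c' : ℕ) : ℤ) - M : ℤ) * w, hc'.trans (Nat.mul_le_mul_left _ (card_le_card ?_))⟩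
  intro b hb
  rw [mem_filter] at hb ⊢
  obtain ⟨hbB, hbc⟩ := hb
  refine ⟨hbB, ?_⟩
  -- on `B` the class is honest: `⌊φ b / w⌋ + M ∈ [0, 2M]`
  have hΘ : |φ b| ≤ Θ := hφ b hbB
  have hΘw : |φ b / w| ≤ (M : ℝ) := by
    rw [abs_div, abs_of_pos hw, div_le_iff₀ hw]
    have : Θ / w ≤ M := Nat.le_ceil _
    calc |φ b| ≤ Θ := hΘ
      _ = Θ / w * w := by field_simp
      _ ≤ M * w := mul_le_mul_of_nonneg_right this hw.le
  obtain ⟨hlo, hhi⟩ := abs_le.mp hΘw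
  have hfl_lo : -(M : ℤ) ≤ ⌊φ b / w⌋ := by
    rw [Int.le_floor]; push_cast; exact hlo
  have hfl_hi : ⌊φ b / w⌋ ≤ (M : ℤ) := by
    have : ⌊φ b / w⌋ ≤ ⌊(M : ℝ)⌋ := Int.floor_mono hhi
    simpa using this
  have hq : ((cls b : ℕ) : ℤ) = ⌊φ b / w⌋ + M := by
    simp only [hcls]
    have h0 : 0 ≤ ⌊φ b / w⌋ + M := by omega
    have h1 : (⌊φ b / w⌋ + M).toNat ≤ 2 * M := by
      have : ⌊φ b / w⌋ + M ≤ (2 * M : ℕ) := by push_cast; omega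
      exact Int.toNat_le.mpr this
    rw [min_eq_left h1, Int.toNat_of_nonneg h0]
  rw [hbc] at hq
  -- so `⌊φ b / w⌋ = c' - M`
  have hfl : ⌊φ b / w⌋ = ((c' : ℕ) : ℤ) - M := by omega
  have h1 := Int.floor_le (φ b / w)
  have h2 := Int.lt_floor_add_one (φ b / w)
  rw [hfl] at h1 h2
  constructor
  · have := mul_le_mul_of_nonneg_right h1 hw.le
    rwa [div_mul_cancel₀ _ hw.ne'] at this
  · have := mul_lt_mul_of_pos_right h2 hw
    rw [div_mul_cancel₀ _ hw.ne', add_mul, one_mul] at this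
    exact this

end Literature.NumberTheory.DiophantineGeometry.Dioph

end
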